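import Literature.Analysis.ODE.JostGreen
import HarnessLib

/-!
# Exponentially decaying solutions of `y'' = (γ₀² + w) y` on a half-line, holomorphic in
# parameters

Topic `Literature/Analysis/ODE` (namespace `Literature.Analysis.ODE`), continuing
`JostGreen.lean`. For `Re γ₀ > γ₁ ≥ 0`, `R₁ ∈ ℝ` and a bounded continuous `w` with
`C_K ‖w‖ < 1` (`C_K` the norm bound of the Green operator), the function
`y(r) = e^{−γ₁(r−R₁)} z(r)`, `z = (1 − K M_w)⁻¹ z₀`, `z₀(r) = e^{−(γ₀−γ₁)(r−R₁)}` (`r ≥ R₁`), is a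
solution of `y'' = (γ₀² + w(r)) y` on `(R₁, ∞)` (`hasDerivAt_jostY`, `hasDerivAt_jostYder`) with
`‖y(r)‖ ≤ C e^{−γ₁(r−R₁)}`, `‖y'(r)‖ ≤ C' e^{−γ₁(r−R₁)}` (`norm_jostY_le`, `norm_jostYder_le`), not
identically zero (`exists_jostY_ne_zero`), and — when `w = w(p)` depends holomorphically on a
parameter — with `y(r; p)`, `y'(r; p)` holomorphic in `p` at each `r > R₁`
(`contDiffAt_jostY_param`, `contDiffAt_jostYder_param`). This is the decaying ("subordinate")
solution at an irregular singular point of rank one with possibly long-range (`O(1/r)`)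
perturbation, constructed by the integral-equation method (Hartman Ch. X §17, Ch. XI §9); it
renders the boundary condition (2.4)–(2.5) "`R ∼ e^{−√(μ²−ω²) r}`" of Shlapentokh-Rothman,
CMP 329 (2014), and the analytic dependence used in his Lemma 4.5. Everything is proved.

## References

* P. Hartman, *Ordinary Differential Equations*, SIAM Classics 38 (2002), Ch. X §17, Ch. XI §9.
  Key `Hartman2002`.
* Y. Shlapentokh-Rothman, Comm. Math. Phys. 329 (2014) 859–891, §2 (2.4)–(2.5), Lemma 4.5.
  Key `ShlapentokhRothman2014KleinGordon`.
-/

noncomputable section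

open Set Filter Metric MeasureTheory intervalIntegral
open scoped Topology ContDiff Interval

namespace Literature.Analysis.ODE

variable {γ₀ : ℂ} {γ₁ : ℝ}

/-! ### The reference function and the fixed point -/

/-- `‖e^{−c t}‖ ≤ 1` for `Re c ≥ 0`, `t ≥ 0`. [folklore] -/
theorem norm_exp_neg_mul_le_one {c : ℂ} (hc : 0 ≤ c.re) {t : ℝ} (ht : 0 ≤ t) :
    ‖Complex.exp (-(c * (t : ℂ)))‖ ≤ 1 := by
  rw [Complex.norm_exp, Complex.neg_re, Complex.mul_re, Complex.ofReal_re, Complex.ofReal_im, mul_zero, sub_zero,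
    Real.exp_le_one_iff]
  nlinarith

/-- **The reference function** `z₀(r) = e^{−(γ₀−γ₁)(max(r,R₁) − R₁)}` in `X`. [folklore] -/
def jostZ₀ (hγ : γ₁ < γ₀.re) (R₁ : ℝ) : BCF :=
  BCF.mk (fun r ↦ Complex.exp (-((γ₀ - γ₁) * ((max r R₁ - R₁ : ℝ) : ℂ)))) (by fun_prop) 1 fun r ↦
    norm_exp_neg_mul_le_one (by simp; linarith) (sub_nonneg.2 (le_max_right _ _))

/-- Values of `z₀`. [folklore] -/
@[simp] theorem jostZ₀_apply (hγ : γ₁ < γ₀.re) (R₁ r : ℝ) :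
    jostZ₀ hγ R₁ r = Complex.exp (-((γ₀ - γ₁) * ((max r R₁ - R₁ : ℝ) : ℂ))) := rfl

/-- `‖z₀‖ ≤ 1`. [folklore] -/
theorem norm_jostZ₀_le (hγ : γ₁ < γ₀.re) (R₁ : ℝ) : ‖jostZ₀ hγ R₁‖ ≤ 1 := BCF.norm_mk_le zero_le_one _

/-- **The operator `T_w = K ∘ M_w`.** [folklore] -/
def jostT (h₁ : 0 ≤ γ₁) (hγ : γ₁ < γ₀.re) (R₁ : ℝ) (w : BCF) : BCF →L[ℂ] BCF := (jostK h₁ hγ R₁).comp (BCF.mulOp w)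

/-- `‖T_w‖ ≤ C_K ‖w‖`. [folklore] -/
theorem norm_jostT_le (h₁ : 0 ≤ γ₁) (hγ : γ₁ < γ₀.re) (R₁ : ℝ) (w : BCF) :
    ‖jostT h₁ hγ R₁ w‖ ≤ jostKconst γ₀ γ₁ * ‖w‖ :=
  (ContinuousLinearMap.opNorm_comp_le _ _).trans
    (mul_le_mul (norm_jostK_le h₁ hγ R₁) (BCF.norm_mulOp_le w) (norm_nonneg _) (jostKconst_nonneg h₁ hγ))

/-- `w ↦ T_w` is a continuous linear, hence smooth, map. [folklore] -/
theorem contDiff_jostT (h₁ : 0 ≤ γ₁) (hγ : γ₁ < γ₀.re) (R₁ : ℝ) {n : WithTop ℕ∞} :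
    ContDiff ℂ n fun w : BCF ↦ jostT h₁ hγ R₁ w :=
  ((ContinuousLinearMap.compL ℂ BCF BCF BCF) (jostK h₁ hγ R₁)).contDiff.comp BCF.contDiff_mulOp

/-- **The weighted solution** `z = (1 − T_w)⁻¹ z₀`. [cite: Hartman2002, Ch. X §17] -/
def jostZ (h₁ : 0 ≤ γ₁) (hγ : γ₁ < γ₀.re) (R₁ : ℝ) (w : BCF) : BCF := nfix (jostT h₁ hγ R₁ w) (jostZ₀ hγ R₁)

/-- **The decaying solution** `y(r) = e^{−γ₁(r−R₁)} z(r)`. [cite: Hartman2002, Ch. X §17] -/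
def jostY (h₁ : 0 ≤ γ₁) (hγ : γ₁ < γ₀.re) (R₁ : ℝ) (w : BCF) (r : ℝ) : ℂ :=
  Complex.exp (-((γ₁ : ℂ) * ((r - R₁ : ℝ) : ℂ))) * jostZ h₁ hγ R₁ w r

section Solution

variable (h₁ : 0 ≤ γ₁) (hγ : γ₁ < γ₀.re) (R₁ : ℝ) {w : BCF} (hw : jostKconst γ₀ γ₁ * ‖w‖ < 1)
include hw

/-- The contraction hypothesis gives `‖T_w‖ < 1`. [folklore] -/
theorem norm_jostT_lt_one : ‖jostT h₁ hγ R₁ w‖ < 1 := (norm_jostT_le h₁ hγ R₁ w).trans_lt hw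

/-- `‖z‖ ≤ 1/(1 − C_K‖w‖)`. [folklore] -/
theorem norm_jostZ_le : ‖jostZ h₁ hγ R₁ w‖ ≤ 1 / (1 - jostKconst γ₀ γ₁ * ‖w‖) := by
  have h := norm_nfix_le (norm_jostT_lt_one h₁ hγ R₁ hw) (jostZ₀ hγ R₁)
  refine h.trans ?_
  have h0 : 0 < 1 - jostKconst γ₀ γ₁ * ‖w‖ := by linarith
  have hT : 1 - jostKconst γ₀ γ₁ * ‖w‖ ≤ 1 - ‖jostT h₁ hγ R₁ w‖ := by linarith [norm_jostT_le h₁ hγ R₁ w]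
  calc ‖jostZ₀ hγ R₁‖ / (1 - ‖jostT h₁ hγ R₁ w‖) ≤ 1 / (1 - ‖jostT h₁ hγ R₁ w‖) := by
        gcongr
        · linarith
        · exact norm_jostZ₀_le hγ R₁
    _ ≤ 1 / (1 - jostKconst γ₀ γ₁ * ‖w‖) := one_div_le_one_div_of_le h0 hT

/-- **The integral equation** `z = z₀ + K(w z)`, pointwise on `r ≥ R₁`. [folklore] -/
theorem jostZ_apply_of_le {r : ℝ} (hr : R₁ ≤ r) :
    jostZ h₁ hγ R₁ w r = Complex.exp (-((γ₀ - γ₁) * ((r - R₁ : ℝ) : ℂ))) +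
      jostKraw γ₀ γ₁ R₁ (BCF.mulOp w (jostZ h₁ hγ R₁ w)) r := by
  have h : jostZ h₁ hγ R₁ w = jostZ₀ hγ R₁ + jostT h₁ hγ R₁ w (jostZ h₁ hγ R₁ w) :=
    nfix_eq (norm_jostT_lt_one h₁ hγ R₁ hw) (jostZ₀ hγ R₁)
  have hr' := congrArg (fun z : BCF ↦ z r) h
  simp only [BoundedContinuousFunction.coe_add, Pi.add_apply, jostZ₀_apply, max_eq_left hr] at hr'
  conv_lhs => rw [hr']
  rw [jostT, ContinuousLinearMap.comp_apply, jostK_apply_of_le h₁ hγ hr]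

/-- The source `φ = w z`. [folklore] -/
def jostPhi : BCF := BCF.mulOp w (jostZ h₁ hγ R₁ w)

omit hw in
/-- Values of the source. [folklore] -/
@[simp] theorem jostPhi_apply (r : ℝ) : jostPhi h₁ hγ R₁ (w := w) r = w r * jostZ h₁ hγ R₁ w r := rfl

/-- **The `y`-representation**: for `r ≥ R₁`,
`y(r) = e^{−γ₀(r−R₁)} − (1/2γ₀)[e^{−γ₀(r−R₁)} J₁(φ)(r) + e^{γ₀(r−R₁)} J₂(φ)(r)]`. [folklore] -/
theorem jostY_eq_of_le {r : ℝ} (hr : R₁ ≤ r) :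
    jostY h₁ hγ R₁ w r = Complex.exp (-(γ₀ * ((r - R₁ : ℝ) : ℂ))) -
      1 / (2 * γ₀) * (Complex.exp (-(γ₀ * ((r - R₁ : ℝ) : ℂ))) * jostJ₁ (γ₀ - γ₁) R₁ (jostPhi h₁ hγ R₁ (w := w)) r +
        Complex.exp (γ₀ * ((r - R₁ : ℝ) : ℂ)) * jostJ₂ (γ₀ + γ₁) R₁ (jostPhi h₁ hγ R₁ (w := w)) r) := by
  rw [jostY, jostZ_apply_of_le h₁ hγ R₁ hw hr, jostKraw, jostPhi]
  set t : ℂ := ((r - R₁ : ℝ) : ℂ)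
  have e1 : Complex.exp (-((γ₁ : ℂ) * t)) * Complex.exp (-((γ₀ - γ₁) * t)) = Complex.exp (-(γ₀ * t)) := by
    rw [← Complex.exp_add]; congr 1; ring
  have e2 : Complex.exp (-((γ₁ : ℂ) * t)) * Complex.exp ((γ₀ + γ₁) * t) = Complex.exp (γ₀ * t) := by
    rw [← Complex.exp_add]; congr 1; ring
  rw [mul_add, e1.symm]
  set J1 := jostJ₁ (γ₀ - γ₁) R₁ (BCF.mulOp w (jostZ h₁ hγ R₁ w)) r
  set J2 := jostJ₂ (γ₀ + γ₁) R₁ (BCF.mulOp w (jostZ h₁ hγ R₁ w)) r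
  rw [← e2]
  ring

/-- The candidate derivative
`y'(r) = −γ₀ e^{−γ₀(r−R₁)} + (1/2)[e^{−γ₀(r−R₁)} J₁(φ)(r) − e^{γ₀(r−R₁)} J₂(φ)(r)]`. [folklore] -/
def jostYder (r : ℝ) : ℂ :=
  -γ₀ * Complex.exp (-(γ₀ * ((r - R₁ : ℝ) : ℂ))) +
    1 / 2 * (Complex.exp (-(γ₀ * ((r - R₁ : ℝ) : ℂ))) * jostJ₁ (γ₀ - γ₁) R₁ (jostPhi h₁ hγ R₁ (w := w)) r -
      Complex.exp (γ₀ * ((r - R₁ : ℝ) : ℂ)) * jostJ₂ (γ₀ + γ₁) R₁ (jostPhi h₁ hγ R₁ (w := w)) r)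

omit hw in
/-- `d/dr e^{c(r−R₁)} = c e^{c(r−R₁)}`. [folklore] -/
theorem hasDerivAt_exp_mul_sub (c : ℂ) (r : ℝ) :
    HasDerivAt (fun s : ℝ ↦ Complex.exp (c * ((s - R₁ : ℝ) : ℂ))) (c * Complex.exp (c * ((r - R₁ : ℝ) : ℂ))) r := by
  have h1 : HasDerivAt (fun s : ℝ ↦ c * ((s - R₁ : ℝ) : ℂ)) c r := by
    have h := ((hasDerivAt_id' r).sub_const R₁).ofReal_comp.const_mul c
    simpa using h
  have h2 := h1.cexp
  convert h2 using 1
  ring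

omit hw in
/-- `d/dr e^{−c(r−R₁)} = −c e^{−c(r−R₁)}`. [folklore] -/
theorem hasDerivAt_exp_neg_mul_sub (c : ℂ) (r : ℝ) :
    HasDerivAt (fun s : ℝ ↦ Complex.exp (-(c * ((s - R₁ : ℝ) : ℂ)))) (-c * Complex.exp (-(c * ((r - R₁ : ℝ) : ℂ)))) r := by
  have h := hasDerivAt_exp_mul_sub R₁ (-c) r
  have hf : (fun s : ℝ ↦ Complex.exp (-c * ((s - R₁ : ℝ) : ℂ))) = fun s : ℝ ↦ Complex.exp (-(c * ((s - R₁ : ℝ) : ℂ))) := by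
    funext s; congr 1; ring
  rw [hf] at h
  convert h using 2
  ring

/-- **First derivative**: `y' = jostYder` on `(R₁, ∞)`. [cite: Hartman2002, Ch. X §17] -/
theorem hasDerivAt_jostY {r : ℝ} (hr : R₁ < r) : HasDerivAt (jostY h₁ hγ R₁ w) (jostYder h₁ hγ R₁ (w := w) r) r := by
  have ha : 0 < (γ₀ - γ₁).re := by simp; linarith
  have hb : 0 < (γ₀ + γ₁).re := by simp; linarith
  set φ := jostPhi h₁ hγ R₁ (w := w) with hφ
  -- `y` coincides near `r` with the representation
  have hloc : (jostY h₁ hγ R₁ w) =ᶠ[𝓝 r] fun s ↦ Complex.exp (-(γ₀ * ((s - R₁ : ℝ) : ℂ))) -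
      1 / (2 * γ₀) * (Complex.exp (-(γ₀ * ((s - R₁ : ℝ) : ℂ))) * jostJ₁ (γ₀ - γ₁) R₁ φ s +
        Complex.exp (γ₀ * ((s - R₁ : ℝ) : ℂ)) * jostJ₂ (γ₀ + γ₁) R₁ φ s) := by
    filter_upwards [Ioi_mem_nhds hr] with s hs using jostY_eq_of_le h₁ hγ R₁ hw hs.le
  have hE1 := hasDerivAt_exp_neg_mul_sub R₁ γ₀ r
  have hE2 := hasDerivAt_exp_mul_sub R₁ γ₀ r
  have hJ1 := hasDerivAt_jostJ₁ (γ₀ - γ₁) R₁ φ r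
  have hJ2 := hasDerivAt_jostJ₂ hb R₁ φ r
  have hF := hE1.sub (((hE1.mul hJ1).add (hE2.mul hJ2)).const_mul (1 / (2 * γ₀)))
  refine (hF.congr_of_eventuallyEq hloc).congr_deriv ?_
  -- the boundary terms from the integrands cancel: `e^{−γ₀ t} e^{a t} = e^{γ₀ t} e^{−b t} = e^{−γ₁ t}`
  set t : ℂ := ((r - R₁ : ℝ) : ℂ)
  have e1 : Complex.exp (-(γ₀ * t)) * Complex.exp ((γ₀ - γ₁) * t) = Complex.exp (γ₀ * t) * Complex.exp (-((γ₀ + γ₁) * t)) := by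
    rw [← Complex.exp_add, ← Complex.exp_add]; congr 1; ring
  have hγ0 : γ₀ ≠ 0 := by intro h; rw [h] at hγ; simp at hγ; linarith
  rw [jostYder]
  have hk : 1 / (2 * γ₀) * γ₀ = 1 / 2 := by field_simp
  linear_combination (-(1 / (2 * γ₀)) * φ r) * e1 +
    (Complex.exp (-(γ₀ * t)) * jostJ₁ (γ₀ - γ₁) R₁ φ r - Complex.exp (γ₀ * t) * jostJ₂ (γ₀ + γ₁) R₁ φ r) * hk

/-- **Second derivative**: `(jostYder)' = (γ₀² + w) y` on `(R₁, ∞)`, i.e. `y'' = (γ₀² + w(r)) y`.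
[cite: Hartman2002, Ch. X §17] -/
theorem hasDerivAt_jostYder {r : ℝ} (hr : R₁ < r) :
    HasDerivAt (jostYder h₁ hγ R₁ (w := w)) ((γ₀ ^ 2 + w r) * jostY h₁ hγ R₁ w r) r := by
  have ha : 0 < (γ₀ - γ₁).re := by simp; linarith
  have hb : 0 < (γ₀ + γ₁).re := by simp; linarith
  set φ := jostPhi h₁ hγ R₁ (w := w) with hφ
  have hE1 := hasDerivAt_exp_neg_mul_sub R₁ γ₀ r
  have hE2 := hasDerivAt_exp_mul_sub R₁ γ₀ r
  have hJ1 := hasDerivAt_jostJ₁ (γ₀ - γ₁) R₁ φ r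
  have hJ2 := hasDerivAt_jostJ₂ hb R₁ φ r
  have hG := (hE1.const_mul (-γ₀)).add (((hE1.mul hJ1).sub (hE2.mul hJ2)).const_mul (1 / 2))
  have hfun : jostYder h₁ hγ R₁ (w := w) = fun s ↦ -γ₀ * Complex.exp (-(γ₀ * ((s - R₁ : ℝ) : ℂ))) +
      1 / 2 * (Complex.exp (-(γ₀ * ((s - R₁ : ℝ) : ℂ))) * jostJ₁ (γ₀ - γ₁) R₁ φ s -
        Complex.exp (γ₀ * ((s - R₁ : ℝ) : ℂ)) * jostJ₂ (γ₀ + γ₁) R₁ φ s) := rfl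
  rw [hfun]
  refine hG.congr_deriv ?_
  rw [jostY_eq_of_le h₁ hγ R₁ hw hr.le]
  set t : ℂ := ((r - R₁ : ℝ) : ℂ)
  have e1 : Complex.exp (-(γ₀ * t)) * Complex.exp ((γ₀ - γ₁) * t) = Complex.exp (-((γ₁ : ℂ) * t)) := by
    rw [← Complex.exp_add]; congr 1; ring
  have e2 : Complex.exp (γ₀ * t) * Complex.exp (-((γ₀ + γ₁) * t)) = Complex.exp (-((γ₁ : ℂ) * t)) := by
    rw [← Complex.exp_add]; congr 1; ring
  have hy : jostY h₁ hγ R₁ w r = Complex.exp (-((γ₁ : ℂ) * t)) * jostZ h₁ hγ R₁ w r := rfl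
  have hφr : φ r = w r * jostZ h₁ hγ R₁ w r := rfl
  have hγ0 : γ₀ ≠ 0 := by intro h; rw [h] at hγ; simp at hγ; linarith
  have hrep := jostY_eq_of_le h₁ hγ R₁ hw hr.le
  rw [← hrep]
  have H : (γ₀ ^ 2 + w r) * jostY h₁ hγ R₁ w r =
      γ₀ ^ 2 * (Complex.exp (-(γ₀ * t)) - 1 / (2 * γ₀) * (Complex.exp (-(γ₀ * t)) * jostJ₁ (γ₀ - γ₁) R₁ φ r +
        Complex.exp (γ₀ * t) * jostJ₂ (γ₀ + γ₁) R₁ φ r)) + w r * (Complex.exp (-((γ₁ : ℂ) * t)) * jostZ h₁ hγ R₁ w r) := by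
    rw [← hy, ← hrep]; ring
  rw [H]
  have hk' : γ₀ ^ 2 * (1 / (2 * γ₀)) = γ₀ / 2 := by field_simp
  linear_combination (Complex.exp (-(γ₀ * t)) * jostJ₁ (γ₀ - γ₁) R₁ φ r + Complex.exp (γ₀ * t) * jostJ₂ (γ₀ + γ₁) R₁ φ r) * hk' +
    (φ r / 2) * e1 + (φ r / 2) * e2 + Complex.exp (-((γ₁ : ℂ) * t)) * hφr

/-! ### Decay and non-vanishing -/

/-- **Decay of `y`**: `‖y(r)‖ ≤ e^{−γ₁(r−R₁)}/(1 − C_K‖w‖)` for all `r`. [cite: Hartman2002, Ch. X §17] -/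
theorem norm_jostY_le (r : ℝ) :
    ‖jostY h₁ hγ R₁ w r‖ ≤ Real.exp (-(γ₁ * (r - R₁))) * (1 / (1 - jostKconst γ₀ γ₁ * ‖w‖)) := by
  rw [jostY, norm_mul, Complex.norm_exp]
  have hre : (-((γ₁ : ℂ) * ((r - R₁ : ℝ) : ℂ))).re = -(γ₁ * (r - R₁)) := by
    simp [Complex.mul_re]
  rw [hre]
  gcongr
  exact (BCF.norm_apply_le _ r).trans (norm_jostZ_le h₁ hγ R₁ hw)

/-- **Decay of `y'`**: `‖y'(r)‖ ≤ C e^{−γ₁(r−R₁)}` on `r ≥ R₁` with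
`C = ‖γ₀‖ + (1/2)(1/(Re γ₀ − γ₁) + 1/(Re γ₀ + γ₁)) ‖w‖/(1 − C_K‖w‖)`. [cite: Hartman2002, Ch. X §17] -/
theorem norm_jostYder_le {r : ℝ} (hr : R₁ ≤ r) :
    ‖jostYder h₁ hγ R₁ (w := w) r‖ ≤ Real.exp (-(γ₁ * (r - R₁))) *
      (‖γ₀‖ + 1 / 2 * (1 / (γ₀.re - γ₁) + 1 / (γ₀.re + γ₁)) * (‖w‖ * (1 / (1 - jostKconst γ₀ γ₁ * ‖w‖)))) := by
  have ha : 0 < (γ₀ - γ₁).re := by simp; linarith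
  have hb : 0 < (γ₀ + γ₁).re := by simp; linarith
  set φ := jostPhi h₁ hγ R₁ (w := w) with hφ
  have hφn : ‖φ‖ ≤ ‖w‖ * (1 / (1 - jostKconst γ₀ γ₁ * ‖w‖)) :=
    (norm_mul_le _ _).trans (mul_le_mul_of_nonneg_left (norm_jostZ_le h₁ hγ R₁ hw) (norm_nonneg _))
  set t : ℂ := ((r - R₁ : ℝ) : ℂ) with ht
  -- split the exponentials: `e^{−γ₀ t} = e^{−γ₁ t} e^{−a t}`, `e^{γ₀ t} = e^{−γ₁ t} e^{b t}`
  have s1 : Complex.exp (-(γ₀ * t)) = Complex.exp (-((γ₁ : ℂ) * t)) * Complex.exp (-((γ₀ - γ₁) * t)) := by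
    rw [← Complex.exp_add]; congr 1; ring
  have s2 : Complex.exp (γ₀ * t) = Complex.exp (-((γ₁ : ℂ) * t)) * Complex.exp ((γ₀ + γ₁) * t) := by
    rw [← Complex.exp_add]; congr 1; ring
  have hw1 : ‖Complex.exp (-((γ₁ : ℂ) * t))‖ = Real.exp (-(γ₁ * (r - R₁))) := by
    rw [Complex.norm_exp]; congr 1; simp [Complex.mul_re, ht]
  have hw0 : ‖Complex.exp (-(γ₀ * t))‖ ≤ Real.exp (-(γ₁ * (r - R₁))) := by
    rw [Complex.norm_exp, Real.exp_le_exp]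
    have : (-(γ₀ * t)).re = -(γ₀.re * (r - R₁)) := by simp [Complex.mul_re, ht]
    rw [this]
    nlinarith [sub_nonneg.2 hr]
  have e1 := norm_exp_mul_jostJ₁_le ha R₁ φ hr
  have e2 := norm_exp_mul_jostJ₂_le hb R₁ φ r
  have hare : (γ₀ - (γ₁ : ℂ)).re = γ₀.re - γ₁ := by simp
  have hbre : (γ₀ + (γ₁ : ℂ)).re = γ₀.re + γ₁ := by simp
  rw [hare] at e1; rw [hbre] at e2
  have hT0 : ‖-γ₀ * Complex.exp (-(γ₀ * t))‖ ≤ ‖γ₀‖ * Real.exp (-(γ₁ * (r - R₁))) := by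
    rw [norm_mul, norm_neg]; gcongr
  have hT1 : ‖Complex.exp (-(γ₀ * t)) * jostJ₁ (γ₀ - γ₁) R₁ φ r‖ ≤ Real.exp (-(γ₁ * (r - R₁))) * (‖φ‖ / (γ₀.re - γ₁)) := by
    rw [s1, mul_assoc, norm_mul, hw1]; gcongr
  have hT2 : ‖Complex.exp (γ₀ * t) * jostJ₂ (γ₀ + γ₁) R₁ φ r‖ ≤ Real.exp (-(γ₁ * (r - R₁))) * (‖φ‖ / (γ₀.re + γ₁)) := by
    rw [s2, mul_assoc, norm_mul, hw1]; gcongr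
  have hpos1 : 0 < γ₀.re - γ₁ := by linarith
  have hpos2 : 0 < γ₀.re + γ₁ := by linarith
  have hE : 0 < Real.exp (-(γ₁ * (r - R₁))) := Real.exp_pos _
  have hφ1 : ‖φ‖ / (γ₀.re - γ₁) ≤ (‖w‖ * (1 / (1 - jostKconst γ₀ γ₁ * ‖w‖))) / (γ₀.re - γ₁) :=
    div_le_div_of_nonneg_right hφn hpos1.le
  have hφ2 : ‖φ‖ / (γ₀.re + γ₁) ≤ (‖w‖ * (1 / (1 - jostKconst γ₀ γ₁ * ‖w‖))) / (γ₀.re + γ₁) :=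
    div_le_div_of_nonneg_right hφn hpos2.le
  rw [jostYder]
  calc ‖-γ₀ * Complex.exp (-(γ₀ * t)) + 1 / 2 * (Complex.exp (-(γ₀ * t)) * jostJ₁ (γ₀ - γ₁) R₁ φ r -
        Complex.exp (γ₀ * t) * jostJ₂ (γ₀ + γ₁) R₁ φ r)‖
      ≤ ‖γ₀‖ * Real.exp (-(γ₁ * (r - R₁))) + 1 / 2 * (Real.exp (-(γ₁ * (r - R₁))) * (‖φ‖ / (γ₀.re - γ₁)) +
          Real.exp (-(γ₁ * (r - R₁))) * (‖φ‖ / (γ₀.re + γ₁))) := by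
        refine (norm_add_le _ _).trans (add_le_add hT0 ?_)
        rw [norm_mul, show ‖(1 / 2 : ℂ)‖ = 1 / 2 by norm_num]
        gcongr
        exact (norm_sub_le _ _).trans (add_le_add hT1 hT2)
    _ ≤ Real.exp (-(γ₁ * (r - R₁))) *
        (‖γ₀‖ + 1 / 2 * (1 / (γ₀.re - γ₁) + 1 / (γ₀.re + γ₁)) * (‖w‖ * (1 / (1 - jostKconst γ₀ γ₁ * ‖w‖)))) := by
        have key : Real.exp (-(γ₁ * (r - R₁))) * (‖φ‖ / (γ₀.re - γ₁)) + Real.exp (-(γ₁ * (r - R₁))) * (‖φ‖ / (γ₀.re + γ₁)) ≤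
            Real.exp (-(γ₁ * (r - R₁))) * ((1 / (γ₀.re - γ₁) + 1 / (γ₀.re + γ₁)) * (‖w‖ * (1 / (1 - jostKconst γ₀ γ₁ * ‖w‖)))) := by
          rw [← mul_add]
          gcongr
          calc ‖φ‖ / (γ₀.re - γ₁) + ‖φ‖ / (γ₀.re + γ₁)
              ≤ (‖w‖ * (1 / (1 - jostKconst γ₀ γ₁ * ‖w‖))) / (γ₀.re - γ₁) +
                (‖w‖ * (1 / (1 - jostKconst γ₀ γ₁ * ‖w‖))) / (γ₀.re + γ₁) := add_le_add hφ1 hφ2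
            _ = (1 / (γ₀.re - γ₁) + 1 / (γ₀.re + γ₁)) * (‖w‖ * (1 / (1 - jostKconst γ₀ γ₁ * ‖w‖))) := by ring
        nlinarith [key, hE]

/-- **`y` does not vanish identically on `(R₁, ∞)`.** [folklore] -/
theorem exists_jostY_ne_zero : ∃ r, R₁ < r ∧ jostY h₁ hγ R₁ w r ≠ 0 := by
  have hb : 0 < (γ₀ + γ₁).re := by simp; linarith
  by_contra hall
  push Not at hall
  -- then `z = 0` on `(R₁, ∞)`, so the source vanishes there and `z(r) = z₀(r) ≠ 0`
  have hz : ∀ r, R₁ < r → jostZ h₁ hγ R₁ w r = 0 := fun r hr ↦ by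
    have h := hall r hr
    rw [jostY, mul_eq_zero] at h
    exact h.resolve_left (Complex.exp_ne_zero _)
  set φ : BCF := BCF.mulOp w (jostZ h₁ hγ R₁ w) with hφ
  have hφ0 : ∀ s, R₁ < s → φ s = 0 := fun s hs ↦ by rw [hφ, BCF.mulOp_apply, hz s hs, mul_zero]
  set r := R₁ + 1 with hr
  have hr1 : R₁ < r := by rw [hr]; linarith
  have hJ1 : jostJ₁ (γ₀ - γ₁) R₁ φ r = 0 := by
    rw [jostJ₁]
    refine intervalIntegral.integral_zero_ae (Eventually.of_forall fun s hs ↦ ?_)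
    rw [uIoc_of_le hr1.le] at hs
    rw [hφ0 s hs.1, mul_zero]
  have hJ2 : jostJ₂ (γ₀ + γ₁) R₁ φ r = 0 := by
    rw [jostJ₂]
    refine setIntegral_eq_zero_of_forall_eq_zero fun s hs ↦ ?_
    rw [hφ0 s (hr1.trans hs), mul_zero]
  have hzr := jostZ_apply_of_le h₁ hγ R₁ hw hr1.le
  rw [hz r hr1, jostKraw, hJ1, hJ2] at hzr
  simp only [mul_zero, add_zero] at hzr
  exact (Complex.exp_ne_zero _) hzr.symm

end Solution

/-! ### Holomorphic dependence on parameters -/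

section Param

variable (h₁ : 0 ≤ γ₁) (hγ : γ₁ < γ₀.re) (R₁ : ℝ)

/-- `J₁(·)(r)` as a continuous linear functional on `X`. [folklore] -/
def jostJ₁CLM (a : ℂ) (R₁ r : ℝ) : BCF →L[ℂ] ℂ :=
  LinearMap.mkContinuous
    { toFun := fun φ ↦ jostJ₁ a R₁ φ r
      map_add' := fun φ ψ ↦ jostJ₁_add a R₁ φ ψ r
      map_smul' := fun c φ ↦ jostJ₁_smul a R₁ c φ r }
    (|r - R₁| * Real.exp (|a.re| * |r - R₁|)) fun φ ↦ by
      simp only [LinearMap.coe_mk, AddHom.coe_mk]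
      rw [jostJ₁]
      have hle : ∀ s ∈ Ι R₁ r, ‖Complex.exp (a * ((s - R₁ : ℝ) : ℂ)) * φ s‖ ≤ Real.exp (|a.re| * |r - R₁|) * ‖φ‖ := by
        intro s hs
        rw [norm_mul, norm_expWeight]
        refine mul_le_mul ?_ (BCF.norm_apply_le φ s) (norm_nonneg _) (Real.exp_pos _).le
        rw [Real.exp_le_exp]
        have h1 : |s - R₁| ≤ |r - R₁| := by
          rcases le_or_gt R₁ r with h | h
          · rw [uIoc_of_le h] at hs
            rw [abs_of_nonneg (by linarith [hs.1]), abs_of_nonneg (by linarith)]; linarith [hs.2]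
          · rw [uIoc_of_ge h.le] at hs
            rw [abs_of_nonpos (by linarith [hs.2]), abs_of_neg (by linarith)]; linarith [hs.1]
        calc a.re * (s - R₁) ≤ |a.re * (s - R₁)| := le_abs_self _
          _ = |a.re| * |s - R₁| := abs_mul _ _
          _ ≤ |a.re| * |r - R₁| := by gcongr
      calc ‖∫ s in R₁..r, Complex.exp (a * ((s - R₁ : ℝ) : ℂ)) * φ s‖ ≤ Real.exp (|a.re| * |r - R₁|) * ‖φ‖ * |r - R₁| :=
            intervalIntegral.norm_integral_le_of_norm_le_const hle
        _ = |r - R₁| * Real.exp (|a.re| * |r - R₁|) * ‖φ‖ := by ring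

/-- Values of `jostJ₁CLM`. [folklore] -/
@[simp] theorem jostJ₁CLM_apply (a : ℂ) (R₁ r : ℝ) (φ : BCF) : jostJ₁CLM a R₁ r φ = jostJ₁ a R₁ φ r := rfl

/-- `J₂(·)(r)` as a continuous linear functional on `X` (`Re b > 0`). [folklore] -/
def jostJ₂CLM {b : ℂ} (hb : 0 < b.re) (R₁ r : ℝ) : BCF →L[ℂ] ℂ :=
  LinearMap.mkContinuous
    { toFun := fun φ ↦ jostJ₂ b R₁ φ r
      map_add' := fun φ ψ ↦ jostJ₂_add hb R₁ φ ψ r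
      map_smul' := fun c φ ↦ jostJ₂_smul b R₁ c φ r }
    (Real.exp (-(b.re * (r - R₁))) / b.re) fun φ ↦ by
      simp only [LinearMap.coe_mk, AddHom.coe_mk]
      have h := norm_exp_mul_jostJ₂_le hb R₁ φ r
      rw [norm_mul, Complex.norm_exp] at h
      have hre : (b * ((r - R₁ : ℝ) : ℂ)).re = b.re * (r - R₁) := by simp [Complex.mul_re]
      rw [hre] at h
      have hexp : 0 < Real.exp (b.re * (r - R₁)) := Real.exp_pos _
      rw [Real.exp_neg]
      calc ‖jostJ₂ b R₁ φ r‖ = (Real.exp (b.re * (r - R₁)))⁻¹ * (Real.exp (b.re * (r - R₁)) * ‖jostJ₂ b R₁ φ r‖) := by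
            field_simp
        _ ≤ (Real.exp (b.re * (r - R₁)))⁻¹ * (‖φ‖ / b.re) := by gcongr
        _ = (Real.exp (b.re * (r - R₁)))⁻¹ / b.re * ‖φ‖ := by ring

/-- Values of `jostJ₂CLM`. [folklore] -/
@[simp] theorem jostJ₂CLM_apply {b : ℂ} (hb : 0 < b.re) (R₁ r : ℝ) (φ : BCF) : jostJ₂CLM hb R₁ r φ = jostJ₂ b R₁ φ r := rfl

variable {P : Type*} [NormedAddCommGroup P] [NormedSpace ℂ P] {wf : P → BCF} {p₀ : P} {n : WithTop ℕ∞}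

/-- **Holomorphy of the weighted solution in parameters**: if `p ↦ w(p) ∈ X` is `Cⁿ` (over `ℂ`)
at `p₀` and `C_K ‖w(p₀)‖ < 1`, then `p ↦ z(p) ∈ X` is `Cⁿ` at `p₀`. [cite: ShlapentokhRothman2014KleinGordon, Lemma 4.5] -/
theorem contDiffAt_jostZ_param (hwf : ContDiffAt ℂ n wf p₀) (hw : jostKconst γ₀ γ₁ * ‖wf p₀‖ < 1) :
    ContDiffAt ℂ n (fun p ↦ jostZ h₁ hγ R₁ (wf p)) p₀ := by
  unfold jostZ
  exact contDiffAt_nfix ((contDiff_jostT h₁ hγ R₁).contDiffAt.comp p₀ hwf) contDiffAt_const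
    (norm_jostT_lt_one h₁ hγ R₁ hw)

/-- The source `p ↦ w(p) z(p)` is `Cⁿ` at `p₀`. [folklore] -/
theorem contDiffAt_jostPhi_param (hwf : ContDiffAt ℂ n wf p₀) (hw : jostKconst γ₀ γ₁ * ‖wf p₀‖ < 1) :
    ContDiffAt ℂ n (fun p ↦ jostPhi h₁ hγ R₁ (w := wf p)) p₀ := by
  unfold jostPhi
  have hbil : ContDiff ℂ n fun q : BCF × BCF ↦ BCF.mulOp q.1 q.2 :=
    (isBoundedBilinearMap_apply.contDiff).comp (BCF.contDiff_mulOp.prodMap contDiff_id)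
  exact hbil.comp_contDiffAt p₀ (hwf.prodMk (contDiffAt_jostZ_param h₁ hγ R₁ hwf hw))

/-- **Holomorphy of `y(r; p)` in `p`** at each fixed `r`. [cite: ShlapentokhRothman2014KleinGordon, Lemma 4.5] -/
theorem contDiffAt_jostY_param (hwf : ContDiffAt ℂ n wf p₀) (hw : jostKconst γ₀ γ₁ * ‖wf p₀‖ < 1) (r : ℝ) :
    ContDiffAt ℂ n (fun p ↦ jostY h₁ hγ R₁ (wf p) r) p₀ := by
  unfold jostY
  have hev : ContDiffAt ℂ n (fun p ↦ BCF.ev r (jostZ h₁ hγ R₁ (wf p))) p₀ :=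
    (BCF.ev r).contDiff.contDiffAt.comp p₀ (contDiffAt_jostZ_param h₁ hγ R₁ hwf hw)
  exact contDiffAt_const.mul hev

/-- **Holomorphy of `y'(r; p)` in `p`** at each fixed `r`. [cite: ShlapentokhRothman2014KleinGordon, Lemma 4.5] -/
theorem contDiffAt_jostYder_param (hwf : ContDiffAt ℂ n wf p₀) (hw : jostKconst γ₀ γ₁ * ‖wf p₀‖ < 1) (r : ℝ) :
    ContDiffAt ℂ n (fun p ↦ jostYder h₁ hγ R₁ (w := wf p) r) p₀ := by
  have hb : 0 < (γ₀ + γ₁).re := by simp; linarith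
  have hφ := contDiffAt_jostPhi_param h₁ hγ R₁ hwf hw
  have hJ1 : ContDiffAt ℂ n (fun p ↦ jostJ₁ (γ₀ - γ₁) R₁ (jostPhi h₁ hγ R₁ (w := wf p)) r) p₀ :=
    (jostJ₁CLM (γ₀ - γ₁) R₁ r).contDiff.contDiffAt.comp p₀ hφ
  have hJ2 : ContDiffAt ℂ n (fun p ↦ jostJ₂ (γ₀ + γ₁) R₁ (jostPhi h₁ hγ R₁ (w := wf p)) r) p₀ :=
    (jostJ₂CLM hb R₁ r).contDiff.contDiffAt.comp p₀ hφ
  unfold jostYder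
  exact contDiffAt_const.add (contDiffAt_const.mul ((contDiffAt_const.mul hJ1).sub (contDiffAt_const.mul hJ2)))

end Param

end Literature.Analysis.ODE

end
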